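import Literature.NumberTheory.LocalFields.BinomialSeriesDifferentialEquation
import Literature.NumberTheory.LocalFields.BinomialCoefficientsPadicIntegral
import Literature.NumberTheory.LocalFields.PadicZeroMultiplicity
import Mathlib.Analysis.Normed.Group.Ultra
import Mathlib.Analysis.Normed.Algebra.Ultra
import Mathlib.Tactic
import HarnessLib

/-!
# Binomial twists of integral power series: if `F' = c·(1+X)^e·F` with `F, F'` `p`-integral of unit
# content, then `e ∈ ℤ_p` (Gouvêa, *p-adic Numbers*, §5.9 Problem 194, via Lemma 5.9.1 converse)

Topic `NumberTheory/LocalFields`; namespace `Literature.NumberTheory.LocalFields`. Everything here is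
proved (theorems only; no definitions, no named facts). `K` is an ultrametric normed field (§4),
resp. a normed `ℚ_p`-algebra (`ℚ_p`, finite extensions, `ℂ_p`; §5). "Integral" means every
coefficient has norm `≤ 1`; the binomial series `(1+X)^e` is any `Q` with `(1 + X)·Q′ = e·Q`
(companion file `BinomialSeriesDifferentialEquation.lean`).

* §4 **`norm_descPochhammer_le_of_binomial_twist`** — if `F' = Q·F` with `(1+X)Q′ = eQ`, `F` and `F'`
  are integral and `F·F'` has a coefficient of norm `1`, then `‖e(e−1)⋯(e−k+1)‖ ≤ ‖k!‖` for every
  `k`, i.e. every `C(e,k)` has norm `≤ 1`. Induction on `k` through the identity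
  (`mul_divided_derivative_eq_sum_of_binomial_twist`)
  `C(e,k)·F'F = F·(1+X)^k F'^{(k)}/k! − F'·Σ_{i<k} C(e,i)(1+X)^{k−i}F^{(k−i)}/(k−i)!`, whose right-hand
  side is integral (divided derivatives `F^{(j)}/j!` of integral series are integral).
  `norm_coeff_mul_eq_one_of_first_unit` — Gauss's lemma: `F·F'` has a coefficient of norm `1` as soon
  as `F` and `F'` do.
* §5 **`exists_padicInt_eq_of_binomial_twist`** / **`exists_padicInt_eq_of_binomial_twist'`** — over a
  normed `ℚ_p`-algebra the exponent `e` then lies in `ℤ_p`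
  (`exists_padicInt_eq_of_norm_descPochhammer_le`, the converse of Gouvêa's Lemma 5.9.1).

Why (use): two `p`-adic measures on a `ℤ_p`-line whose values at the nodes `uᵗ − 1` differ by
`c·dᵗ` are related by `F' = c·(1+X)^e·F` with `d = u^e`; this file is the step "`e ∈ ℤ_p`", i.e.
`d ∈ u^{ℤ_p}` and the twist `(1+X)^e` is itself an Iwasawa function (a unit of `𝒪⟦X⟧`).

## References

* F. Q. Gouvêa, *p-adic Numbers: An Introduction*, Universitext, Springer 1993, §5.9 Lemma 5.9.1
  and Problem 194 (held text pp. 131–132). [Gouvea1993PadicNumbers]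
-/

noncomputable section

open Finset PowerSeries

namespace Literature.NumberTheory.LocalFields

/-! ## §4. Integrality: `F' = Q·F` with `F, F'` integral of unit content forces `C(e,k)` integral -/

section Integral

variable {K : Type*} [NormedField K] [IsUltrametricDist K]

/-- Sums of integral series are integral. [folklore] -/
private theorem bst_int_add {F G : K⟦X⟧} (hF : ∀ n, ‖coeff n F‖ ≤ 1) (hG : ∀ n, ‖coeff n G‖ ≤ 1)
    (n : ℕ) : ‖coeff n (F + G)‖ ≤ 1 := by
  rw [map_add]; exact (IsUltrametricDist.norm_add_le_max _ _).trans (max_le (hF n) (hG n))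

/-- Differences of integral series are integral. [folklore] -/
private theorem bst_int_sub {F G : K⟦X⟧} (hF : ∀ n, ‖coeff n F‖ ≤ 1) (hG : ∀ n, ‖coeff n G‖ ≤ 1)
    (n : ℕ) : ‖coeff n (F - G)‖ ≤ 1 := by
  rw [sub_eq_add_neg]
  exact bst_int_add hF (fun m ↦ by rw [map_neg, norm_neg]; exact hG m) n

/-- Products of integral series are integral. [folklore] -/
private theorem bst_int_mul {F G : K⟦X⟧} (hF : ∀ n, ‖coeff n F‖ ≤ 1) (hG : ∀ n, ‖coeff n G‖ ≤ 1)
    (n : ℕ) : ‖coeff n (F * G)‖ ≤ 1 := by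
  rw [coeff_mul]
  refine IsUltrametricDist.norm_sum_le_of_forall_le_of_nonneg zero_le_one fun ij _ ↦ ?_
  rw [norm_mul]
  exact mul_le_one₀ (hF _) (norm_nonneg _) (hG _)

/-- Finite sums of integral series are integral. [folklore] -/
private theorem bst_int_sum {ι : Type*} {s : Finset ι} {F : ι → K⟦X⟧}
    (hF : ∀ i ∈ s, ∀ n, ‖coeff n (F i)‖ ≤ 1) (n : ℕ) : ‖coeff n (∑ i ∈ s, F i)‖ ≤ 1 := by
  rw [map_sum]
  exact IsUltrametricDist.norm_sum_le_of_forall_le_of_nonneg zero_le_one fun i hi ↦ hF i hi n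

omit [IsUltrametricDist K] in
/-- A constant of norm `≤ 1` times an integral series is integral. [folklore] -/
private theorem bst_int_C_mul {c : K} (hc : ‖c‖ ≤ 1) {F : K⟦X⟧} (hF : ∀ n, ‖coeff n F‖ ≤ 1)
    (n : ℕ) : ‖coeff n (C c * F)‖ ≤ 1 := by
  rw [coeff_C_mul, norm_mul]; exact mul_le_one₀ hc (norm_nonneg _) (hF n)

/-- `(1 + X)^m` is integral. [folklore] -/
private theorem bst_int_one_add_X_pow (m n : ℕ) : ‖coeff n ((1 + X : K⟦X⟧) ^ m)‖ ≤ 1 := by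
  induction m generalizing n with
  | zero =>
    rw [pow_zero, coeff_one]
    split_ifs <;> simp
  | succ m ih =>
    rw [pow_succ]
    refine bst_int_mul ih (fun k ↦ ?_) n
    rw [map_add, coeff_one, coeff_X]
    rcases Nat.lt_trichotomy k 1 with hk | hk | hk
    · have : k = 0 := by omega
      subst this; simp
    · subst hk; simp
    · rw [if_neg (by omega), if_neg (by omega), add_zero, norm_zero]; exact zero_le_one

/-- **Gauss's lemma for the unit content**: if `F` and `F'` have coefficients of norm `≤ 1` and
first coefficients of norm `1` in degrees `N` and `N'`, then the coefficient of `F·F'` in degree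
`N + N'` has norm `1` (Gouvêa's proof of `‖fg‖_c = ‖f‖_c‖g‖_c`: the coefficient at the sum of
the first dominant indices is dominated by the single product of the dominant coefficients).
[cite: Gouvea1993PadicNumbers, Thm. 7.2.1 (iii) (proof) / Thm. 7.2.5 (iii)] -/
theorem norm_coeff_mul_eq_one_of_first_unit {F F' : K⟦X⟧}
    (hFi : ∀ n, ‖coeff n F‖ ≤ 1) (hF'i : ∀ n, ‖coeff n F'‖ ≤ 1) {N N' : ℕ}
    (hN : ‖coeff N F‖ = 1) (hNlt : ∀ n < N, ‖coeff n F‖ < 1)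
    (hN' : ‖coeff N' F'‖ = 1) (hN'lt : ∀ n < N', ‖coeff n F'‖ < 1) :
    ‖coeff (N + N') (F * F')‖ = 1 := by
  rw [coeff_mul, ← Finset.add_sum_erase _ _ (mem_antidiagonal.2 rfl : (N, N') ∈ antidiagonal (N + N'))]
  have hmain : ‖coeff N F * coeff N' F'‖ = 1 := by rw [norm_mul, hN, hN', mul_one]
  have hrest : ‖∑ ij ∈ (antidiagonal (N + N')).erase (N, N'), coeff ij.1 F * coeff ij.2 F'‖ < 1 := by
    have h0 : (0 : ℝ) < 1 := one_pos
    rcases ((antidiagonal (N + N')).erase (N, N')).eq_empty_or_nonempty with he | hne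
    · rw [he, sum_empty, norm_zero]; exact h0
    refine (hne.norm_sum_le_sup'_norm _).trans_lt ((Finset.sup'_lt_iff hne).2 fun ij hij ↦ ?_)
    obtain ⟨hne', hij'⟩ := mem_erase.1 hij
    have hsum := mem_antidiagonal.1 hij'
    rw [norm_mul]
    rcases Nat.lt_or_ge ij.1 N with h | h
    · exact mul_lt_one_of_nonneg_of_lt_one_left (norm_nonneg _) (hNlt _ h) (hF'i _)
    · have h2 : ij.2 < N' := by
        rcases Nat.lt_or_ge ij.2 N' with h2 | h2
        · exact h2
        · exfalso; apply hne'
          exact Prod.ext (by omega) (by omega)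
      exact mul_lt_one_of_nonneg_of_lt_one_right (hFi _) (norm_nonneg _) (hN'lt _ h2)
  rw [IsUltrametricDist.norm_add_eq_max_of_norm_ne_norm (by rw [hmain]; exact hrest.ne'), hmain]
  exact max_eq_left hrest.le

variable [CharZero K]

omit [IsUltrametricDist K] in
/-- The divided derivative `F^{(k)}/k!` of an integral series is integral (its coefficients are
`C(n+k, k)·a_{n+k}`). [folklore] -/
private theorem bst_int_divided_derivative {F : K⟦X⟧} (hF : ∀ n, ‖coeff n F‖ ≤ 1)
    (hnat : ∀ m : ℕ, ‖(m : K)‖ ≤ 1) (k n : ℕ) :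
    ‖coeff n (C ((k.factorial : K)⁻¹) * (derivative K)^[k] F)‖ ≤ 1 := by
  rw [coeff_C_mul, coeff_iterate_derivative, Nat.descFactorial_eq_factorial_mul_choose, Nat.cast_mul,
    ← mul_assoc, ← mul_assoc, inv_mul_cancel₀ (by exact_mod_cast Nat.factorial_ne_zero k), one_mul,
    norm_mul]
  exact mul_le_one₀ (hnat _) (norm_nonneg _) (hF _)

omit [IsUltrametricDist K] in
/-- **The key identity.** If `F' = Q·F` with `(1+X)Q′ = eQ`, then for every `k`
`F·(1+X)^k·F'^{(k)}/k! = F'·Σ_{i+j=k} (e(e−1)⋯(e−i+1)/i!)·(1+X)^j·F^{(j)}/j!`.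
[cite: Gouvea1993PadicNumbers, §5.9 (the binomial series `B(α, X)`, p. 131)] -/
theorem mul_divided_derivative_eq_sum_of_binomial_twist {F F' Q : K⟦X⟧} {e : K}
    (hQ : (1 + X) * derivative K Q = C e * Q) (hF' : F' = Q * F) (k : ℕ) :
    F * ((1 + X) ^ k * (C ((k.factorial : K)⁻¹) * (derivative K)^[k] F')) =
      F' * ∑ ij ∈ antidiagonal k, C ((∏ l ∈ range ij.1, (e - (l : K))) / (ij.1.factorial : K)) *
        ((1 + X) ^ ij.2 * (C ((ij.2.factorial : K)⁻¹) * (derivative K)^[ij.2] F)) := by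
  rw [hF', iterate_derivative_mul_eq_sum_antidiagonal, mul_sum, mul_sum, mul_sum, mul_sum]
  refine sum_congr rfl fun ij hij ↦ ?_
  have hk : k = ij.1 + ij.2 := (mem_antidiagonal.1 hij).symm
  have hfact : ((k.factorial : K)⁻¹) * (k.choose ij.1 : ℕ) =
      ((ij.1.factorial : K)⁻¹) * ((ij.2.factorial : K)⁻¹) := by
    have h1 : ((k.choose ij.1 : ℕ) : K) * ij.1.factorial * ij.2.factorial = k.factorial := by
      rw [hk, Nat.choose_symm_add]; exact_mod_cast Nat.add_choose_mul_factorial_mul_factorial ij.1 ij.2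
    have h2 : (ij.1.factorial : K) ≠ 0 := by exact_mod_cast Nat.factorial_ne_zero _
    have h3 : (ij.2.factorial : K) ≠ 0 := by exact_mod_cast Nat.factorial_ne_zero _
    have h4 : (k.factorial : K) ≠ 0 := by exact_mod_cast Nat.factorial_ne_zero _
    field_simp
    linear_combination h1
  have hpow : (1 + X : K⟦X⟧) ^ k = (1 + X) ^ ij.1 * (1 + X) ^ ij.2 := by rw [hk, pow_add]
  -- `(1+X)^i Q^{(i)} = C P_i Q`
  have hI := one_add_X_pow_mul_iterate_derivative_of_ode hQ ij.1
  calc F * ((1 + X) ^ k * (C ((k.factorial : K)⁻¹) *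
          (((k.choose ij.1 : ℕ) : K⟦X⟧) * ((derivative K)^[ij.1] Q * (derivative K)^[ij.2] F))))
      = F * (C (((k.factorial : K)⁻¹) * (k.choose ij.1 : ℕ)) *
          (((1 + X) ^ ij.1 * (derivative K)^[ij.1] Q) * ((1 + X) ^ ij.2 * (derivative K)^[ij.2] F))) := by
        rw [hpow, map_mul, map_natCast]; ring
    _ = F * (C (((ij.1.factorial : K)⁻¹) * ((ij.2.factorial : K)⁻¹)) *
          ((C (∏ j ∈ range ij.1, (e - (j : K))) * Q) * ((1 + X) ^ ij.2 * (derivative K)^[ij.2] F))) := by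
        rw [hfact, hI]
    _ = _ := by rw [map_mul, div_eq_mul_inv, map_mul]; ring

/-- **`‖e(e−1)⋯(e−k+1)‖ ≤ ‖k!‖` for every `k`** (all binomial coefficients `C(e,k)` have norm `≤ 1`):
if `F' = Q·F` with `(1+X)Q′ = eQ` (i.e. `F' = c·(1+X)^e·F`), `F` and `F'` have coefficients of norm
`≤ 1`, some coefficient of `F·F'` has norm `1`, and the natural numbers have norm `≤ 1` in `K`.
[cite: Gouvea1993PadicNumbers, §5.9 Lemma 5.9.1 (converse) and Problem 194] -/
theorem norm_descPochhammer_le_of_binomial_twist {F F' Q : K⟦X⟧} {e : K}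
    (hQ : (1 + X) * derivative K Q = C e * Q) (hF' : F' = Q * F)
    (hFi : ∀ n, ‖coeff n F‖ ≤ 1) (hF'i : ∀ n, ‖coeff n F'‖ ≤ 1) {N : ℕ} (hN : ‖coeff N (F * F')‖ = 1)
    (hnat : ∀ m : ℕ, ‖(m : K)‖ ≤ 1) (k : ℕ) :
    ‖∏ j ∈ range k, (e - (j : K))‖ ≤ ‖(k.factorial : K)‖ := by
  induction k using Nat.strong_induction_on with
  | _ k ih =>
    have hkf : (k.factorial : K) ≠ 0 := by exact_mod_cast Nat.factorial_ne_zero k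
    -- it suffices to bound the norm of `c_k = P_k / k!` by `1`
    suffices h : ‖(∏ j ∈ range k, (e - (j : K))) / (k.factorial : K)‖ ≤ 1 by
      rwa [norm_div, div_le_one (norm_pos_iff.2 hkf)] at h
    set c : ℕ → K := fun i ↦ (∏ j ∈ range i, (e - (j : K))) / (i.factorial : K) with hc
    have hci : ∀ i < k, ‖c i‖ ≤ 1 := fun i hi ↦ by
      have hif : (i.factorial : K) ≠ 0 := by exact_mod_cast Nat.factorial_ne_zero i
      rw [hc, norm_div, div_le_one (norm_pos_iff.2 hif)]
      exact ih i hi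
    -- the key identity, with the `(k, 0)` term isolated
    have hkey := mul_divided_derivative_eq_sum_of_binomial_twist hQ hF' k
    have hmem : (k, 0) ∈ antidiagonal k := by simp
    rw [← Finset.add_sum_erase _ _ hmem] at hkey
    simp only [pow_zero, Nat.factorial_zero, Nat.cast_one, inv_one, map_one, one_mul,
      Function.iterate_zero, id_eq] at hkey
    -- `c_k · F'F = F(1+X)^k F'^{(k)}/k! − F' Σ_{(i,j) ≠ (k,0)} c_i (1+X)^j F^{(j)}/j!`
    have hsolve : C (c k) * (F * F') =
        F * ((1 + X) ^ k * (C ((k.factorial : K)⁻¹) * (derivative K)^[k] F')) -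
          F' * ∑ ij ∈ (antidiagonal k).erase (k, 0), C (c ij.1) *
            ((1 + X) ^ ij.2 * (C ((ij.2.factorial : K)⁻¹) * (derivative K)^[ij.2] F)) := by
      rw [hkey, hc]; ring
    -- the right-hand side is integral
    have hint : ∀ n, ‖coeff n (C (c k) * (F * F'))‖ ≤ 1 := by
      intro n
      rw [hsolve]
      refine bst_int_sub (bst_int_mul hFi (bst_int_mul (bst_int_one_add_X_pow k)
        (bst_int_divided_derivative hF'i hnat k))) (bst_int_mul hF'i (bst_int_sum fun ij hij ↦ ?_)) n
      obtain ⟨hne, hij⟩ := mem_erase.1 hij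
      have hi : ij.1 < k := by
        have hsum := mem_antidiagonal.1 hij
        rcases Nat.lt_or_ge ij.1 k with h | h
        · exact h
        · exfalso; apply hne
          have h1 : ij.1 = k := by omega
          have h2 : ij.2 = 0 := by omega
          exact Prod.ext h1 h2
      exact bst_int_C_mul (hci ij.1 hi) (bst_int_mul (bst_int_one_add_X_pow ij.2)
        (bst_int_divided_derivative hFi hnat ij.2))
    have h := hint N
    rw [coeff_C_mul, norm_mul, hN, mul_one] at h
    exact h

end Integral

/-! ## §5. Over a normed `ℚ_p`-algebra: the exponent lies in `ℤ_p` -/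

section Padic

variable {p : ℕ} [hp : Fact p.Prime] {K : Type*} [NormedField K] [instK : NormedAlgebra ℚ_[p] K]

include instK in
/-- `‖m‖ ≤ 1` for natural numbers in a normed `ℚ_p`-algebra. [folklore] -/
private theorem bst_norm_natCast_le_one (m : ℕ) : ‖(m : K)‖ ≤ 1 := by
  rw [← map_natCast (algebraMap ℚ_[p] K) m, norm_algebraMap']
  exact_mod_cast Padic.norm_int_le_one (p := p) m

/-- **The exponent of a binomial twist between integral series of unit content is a `p`-adic
integer.** If `F' = Q·F` in `K⟦X⟧` (`K` a normed `ℚ_p`-algebra, e.g. `ℂ_p`) with `(1+X)Q′ = eQ`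
(i.e. `F' = c·(1+X)^e·F`), `F` and `F'` have coefficients of norm `≤ 1` and `F·F'` has a
coefficient of norm `1`, then `e ∈ ℤ_p`. [cite: Gouvea1993PadicNumbers, §5.9 Lemma 5.9.1 (converse) and Problem 194] -/
theorem exists_padicInt_eq_of_binomial_twist {F F' Q : K⟦X⟧} {e : K}
    (hQ : (1 + X) * derivative K Q = C e * Q) (hF' : F' = Q * F)
    (hFi : ∀ n, ‖coeff n F‖ ≤ 1) (hF'i : ∀ n, ‖coeff n F'‖ ≤ 1) {N : ℕ} (hN : ‖coeff N (F * F')‖ = 1) :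
    ∃ z : ℤ_[p], algebraMap ℚ_[p] K (z : ℚ_[p]) = e := by
  have : IsUltrametricDist K := IsUltrametricDist.of_normedAlgebra ℚ_[p]
  have : CharZero K := charZero_of_injective_algebraMap (algebraMap ℚ_[p] K).injective
  exact exists_padicInt_eq_of_norm_descPochhammer_le (p := p) fun k ↦
    norm_descPochhammer_le_of_binomial_twist hQ hF' hFi hF'i hN (bst_norm_natCast_le_one (p := p)) k

/-- The exponent of a binomial twist is a `p`-adic integer — variant assuming only that `F` and
`F'` each have SOME coefficient of norm `1` (unit content), via Gauss's lemma.
[cite: Gouvea1993PadicNumbers, §5.9 Lemma 5.9.1 (converse) and Problem 194] -/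
theorem exists_padicInt_eq_of_binomial_twist' {F F' Q : K⟦X⟧} {e : K}
    (hQ : (1 + X) * derivative K Q = C e * Q) (hF' : F' = Q * F)
    (hFi : ∀ n, ‖coeff n F‖ ≤ 1) (hF'i : ∀ n, ‖coeff n F'‖ ≤ 1)
    (hFu : ∃ n, ‖coeff n F‖ = 1) (hF'u : ∃ n, ‖coeff n F'‖ = 1) :
    ∃ z : ℤ_[p], algebraMap ℚ_[p] K (z : ℚ_[p]) = e := by
  have : IsUltrametricDist K := IsUltrametricDist.of_normedAlgebra ℚ_[p]
  classical
  -- first unit coefficients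
  let N := Nat.find hFu
  let N' := Nat.find hF'u
  have hN : ‖coeff N F‖ = 1 := Nat.find_spec hFu
  have hN' : ‖coeff N' F'‖ = 1 := Nat.find_spec hF'u
  have hNlt : ∀ n < N, ‖coeff n F‖ < 1 := fun n hn ↦
    lt_of_le_of_ne (hFi n) (Nat.find_min hFu hn)
  have hN'lt : ∀ n < N', ‖coeff n F'‖ < 1 := fun n hn ↦
    lt_of_le_of_ne (hF'i n) (Nat.find_min hF'u hn)
  exact exists_padicInt_eq_of_binomial_twist (p := p) hQ hF' hFi hF'i
    (norm_coeff_mul_eq_one_of_first_unit hFi hF'i hN hNlt hN' hN'lt)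

end Padic

end Literature.NumberTheory.LocalFields
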